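import Mathlib

/-!
# Even log-convex sequences on an odd cycle are non-increasing on the half period
(crux `ConvexGribovBody.PoincareToGap`, line `Sketch`, stub F4b)

Let `L = 2S + 1` and let `c : ZMod L → ℝ` be non-negative, even (`c (-n) = c n`) and
log-convex at every non-zero residue (`c n ^ 2 ≤ c (n - 1) * c (n + 1)` for `n ≠ 0`).
Then `c` is non-increasing along `0, 1, …, S`: for naturals `n ≤ k ≤ S` one has
`c k ≤ c n`.

In the composition of the crux, `c n` is the autocovariance at time separation `n` of a
layer observable on a torus of odd period `L`; positivity, evenness and log-convexity come
from reflection positivity.  The present file is the elementary real-analysis step.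

Proof (folklore).  Evenness gives `c (S + 1) = c (-S) = c S`, because
`(S + 1) + S = L = 0` in `ZMod L`.  Log-convexity at the residue `S` therefore reads
`c S ^ 2 ≤ c (S - 1) * c S`, whence `c S ≤ c (S - 1)` (divide by `c S` if it is positive,
and use `0 ≤ c (S - 1)` otherwise).  Descending from `S`: if `c (j + 1) ≤ c j` for some
`1 ≤ j < S`, then log-convexity at `j` gives `c j ^ 2 ≤ c (j - 1) * c (j + 1) ≤ c (j - 1) * c j`,
whence again `c j ≤ c (j - 1)`.  Chaining the one-step inequalities proves the claim.
The residues `1, …, S` are non-zero in `ZMod L` since `0 < j < L`.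
-/

namespace Summit.QuantumFields.YangMills.Theorems.PoincareToGap

/-- If `0 ≤ x`, `0 ≤ a` and `x ^ 2 ≤ a * x`, then `x ≤ a`. -/
private theorem le_of_sq_le_mul_self_F4b {x a : ℝ} (hx : 0 ≤ x) (ha : 0 ≤ a)
    (h : x ^ 2 ≤ a * x) : x ≤ a := by
  rcases hx.eq_or_lt with h0 | hxpos
  · rw [← h0]
    exact ha
  · have h' : x * x ≤ a * x := by simpa only [sq] using h
    exact le_of_mul_le_mul_right h' hxpos

/-- **Stub F4b.**  A non-negative, even sequence on `ZMod (2S+1)` which is log-convex at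
every non-zero residue is non-increasing along `0, 1, …, S`. -/
theorem stub_antitone_of_logConvex :
    ∀ (S : ℕ) (c : ZMod (2 * S + 1) → ℝ), (∀ n, 0 ≤ c n) → (∀ n, c (-n) = c n) →
      (∀ n, n ≠ 0 → c n ^ 2 ≤ c (n - 1) * c (n + 1)) →
    ∀ n k : ℕ, n ≤ k → k ≤ S → c (k : ZMod (2 * S + 1)) ≤ c (n : ZMod (2 * S + 1)) := by
  intro S c hpos heven hlc
  -- The residues `1, …, S` are non-zero in `ZMod (2S+1)`.
  have hne : ∀ j : ℕ, 1 ≤ j → j ≤ S → ((j : ℕ) : ZMod (2 * S + 1)) ≠ 0 := by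
    intro j hj1 hjS h
    have h1 := congrArg ZMod.val h
    rw [ZMod.val_natCast, ZMod.val_zero, Nat.mod_eq_of_lt (by omega)] at h1
    omega
  -- Log-convexity in `ℕ`-language at the residues `1, …, S`.
  have hlc' : ∀ j : ℕ, 1 ≤ j → j ≤ S →
      c (j : ZMod (2 * S + 1)) ^ 2 ≤
        c ((j - 1 : ℕ) : ZMod (2 * S + 1)) * c ((j + 1 : ℕ) : ZMod (2 * S + 1)) := by
    intro j hj1 hjS
    have e1 : ((j - 1 : ℕ) : ZMod (2 * S + 1)) = (j : ZMod (2 * S + 1)) - 1 := by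
      rw [Nat.cast_sub hj1, Nat.cast_one]
    have e2 : ((j + 1 : ℕ) : ZMod (2 * S + 1)) = (j : ZMod (2 * S + 1)) + 1 :=
      Nat.cast_succ j
    rw [e1, e2]
    exact hlc _ (hne j hj1 hjS)
  -- Wrap-around at the antipode: `c (S+1) = c (-S) = c S`.
  have hwrap : c ((S + 1 : ℕ) : ZMod (2 * S + 1)) = c (S : ZMod (2 * S + 1)) := by
    have hsum : ((S + 1 : ℕ) : ZMod (2 * S + 1)) + (S : ZMod (2 * S + 1)) = 0 :=
      calc ((S + 1 : ℕ) : ZMod (2 * S + 1)) + (S : ZMod (2 * S + 1))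
          = ((2 * S + 1 : ℕ) : ZMod (2 * S + 1)) := by push_cast; ring
        _ = 0 := ZMod.natCast_self _
    rw [eq_neg_of_add_eq_zero_left hsum, heven]
  -- One-step descent `c j ≤ c (j-1)` for `1 ≤ j ≤ S`, by downward induction from `j = S`
  -- (the induction variable `m` is the distance `S - j`).
  have hstep : ∀ m j : ℕ, 1 ≤ j → j + m = S →
      c (j : ZMod (2 * S + 1)) ≤ c ((j - 1 : ℕ) : ZMod (2 * S + 1)) := by
    intro m
    induction m with
    | zero =>
      intro j hj1 hjS
      have hjS' : j = S := by omega
      subst hjS'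
      have h := hlc' _ hj1 le_rfl
      rw [hwrap] at h
      exact le_of_sq_le_mul_self_F4b (hpos _) (hpos _) h
    | succ m ih =>
      intro j hj1 hjS
      have h1 := ih (j + 1) (by omega) (by omega)
      rw [Nat.add_sub_cancel] at h1
      have h := (hlc' j hj1 (by omega)).trans (mul_le_mul_of_nonneg_left h1 (hpos _))
      exact le_of_sq_le_mul_self_F4b (hpos _) (hpos _) h
  have hstep' : ∀ j : ℕ, 1 ≤ j → j ≤ S →
      c (j : ZMod (2 * S + 1)) ≤ c ((j - 1 : ℕ) : ZMod (2 * S + 1)) :=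
    fun j hj1 hjS => hstep (S - j) j hj1 (by omega)
  -- Chain the one-step inequalities.
  intro n k hnk hkS
  induction k with
  | zero =>
    have hn : n = 0 := by omega
    subst hn
    exact le_rfl
  | succ k ih =>
    by_cases hn : n = k + 1
    · subst hn
      exact le_rfl
    · have h1 := hstep' (k + 1) (by omega) hkS
      rw [Nat.add_sub_cancel] at h1
      exact h1.trans (ih (by omega) (by omega))

end Summit.QuantumFields.YangMills.Theorems.PoincareToGap
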